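import Literature.NumberTheory.Automorphic.LocalSchwartzBruhatDirectSum
import Literature.NumberTheory.Automorphic.UnitaryGroupDirectSum
import Literature.RepresentationTheory.HeisenbergGroup.SchrodingerModel
import HarnessLib

/-!
# The Schrödinger model of an orthogonal direct sum `W₁ ⊕ W₂` on `𝒮(K^ι) = 𝒮(K^{ι₁}) ⊗ 𝒮(K^{ι₂})`

Topic `RepresentationTheory/HeisenbergGroup`; namespace `Literature.RepresentationTheory.HeisenbergGroup`. KERNEL
MATHEMATICS ONLY (definitions with bodies + theorems; no named fact, no `axiom`, no `sorry`). The single-place,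
coordinate-reindexed twin of the tree's `Weil1964/AdelicMetaplecticDirectSum` §1–§2.

Setting: a commutative ring (later: a non-archimedean local field) `K`, index types `ι₁, ι₂, ι` with an enumeration
`e : ι₁ ⊕ ι₂ ≃ ι`, Gram matrices `T₁, T₂` and a Gram matrix `T` on `ι` which IS the block sum read through `e`,
`hT : T = reindex e e (fromBlocks T₁ 0 0 T₂)` (the case of record: `ι = Fin (n + n)`, `e = finSumFinEquiv`,
`T = T₀ ⊕ (−T₀)`, the doubled space of [Kudla1994, §2] / [HarrisKudlaSweet1996, §1]). The symplectic spaces are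
`W_T = K^ι × K^ι` with `polar β_T`, `β_T(x, y) = x ⬝ᵥ T y` (the coordinates of all the tree's Schrödinger files).

* §1 `β_T = β_{T₁} ⊕ β_{T₂}` along `e` (`toLinearMap₂'_blocks`); the Heisenberg embeddings
  `inlH : H(W_{T₁}) →* H(W_T)`, `inrH : H(W_{T₂}) →* H(W_T)` (`a ↦ (a ⊔ 0, t)`, `b ↦ (0 ⊔ b, t)`; homomorphisms because
  the summands are `β_T`-orthogonal), and the factorisation `h = inlH(h|₁) · inrH(h|₂, 0)` of every element of `H(W_T)`;
* §2 the symplectic embedding `spInl : Sp(W_{T₁}) →* Sp(W_T)`, `g₁ ↦ g₁ ⊕ 1` read through `e`, and its compatibility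
  with Weil's section `ofSymplectic`: `(g₁ ⊕ 1) · inlH h₁ = inlH (g₁ · h₁)`, `(g₁ ⊕ 1) · inrH h₂ = inrH h₂`
  [Weil1964, Chap. I n° 5; Kudla1984, §1];
* §3 over a non-archimedean local field, on the products `f₁ ⊠ f₂ = boxSB K e f₁ f₂` of
  `LocalSchwartzBruhatDirectSum`: **`ρ_T(inlH h₁)(f₁ ⊠ f₂) = ρ_{T₁}(h₁) f₁ ⊠ f₂`**,
  **`ρ_T(inrH h₂)(f₁ ⊠ f₂) = f₁ ⊠ ρ_{T₂}(h₂) f₂`**, i.e. `ρ_T ∘ inrH = 1 ⊠ ρ_{T₂}` as operators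
  [MoeglinVignerasWaldspurger1987, Chap. 2 I.4 Exemple (1), II.1 Rem. (6); Weil1964, Chap. III n° 38].

## References
* [Weil1964] A. Weil, *Sur certains groupes d'opérateurs unitaires*, Acta Math. 111 (1964), n° 4–5, n° 38.
* [MoeglinVignerasWaldspurger1987] C. Mœglin, M.-F. Vignéras, J.-L. Waldspurger, LNM 1291 (1987), Chap. 2 I.4, II.1.
* [Kudla1984] S. Kudla, *Seesaw dual reductive pairs*, Progr. Math. 46 (1984), §1.

## Provenance

LEAN-IN-TREE rule, pub-hodgecm stage-1 cell, seat GR-1 ≡ own-real34 (local undoubling of the cite-free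
[GelbartRogawski1991, Prop. 3.1.1] package).
-/

set_option autoImplicit false

noncomputable section

namespace Literature.RepresentationTheory.HeisenbergGroup

open Literature.NumberTheory.Automorphic

/-! ## §1 `β_T = β_{T₁} ⊕ β_{T₂}` along `e`; the Heisenberg embeddings -/

section Blocks

variable {K : Type*} [CommRing K] {ι₁ ι₂ ι : Type*} (e : ι₁ ⊕ ι₂ ≃ ι)

local notation "𝕎" => ((ι → K) × (ι → K))
local notation "𝕎₁" => ((ι₁ → K) × (ι₁ → K))
local notation "𝕎₂" => ((ι₂ → K) × (ι₂ → K))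

/-! ## §1 `W_T = W_{T₁} × W_{T₂}` along `e` and the automorphisms `g₁ ⊕ 1` -/

/-- `W_T ≃ W_{T₁} × W_{T₂}` along `e`: `(x, y) ↦ ((x|₁, y|₁), (x|₂, y|₂))`. [cite: Kudla1984, §1] -/
def splitW : 𝕎 ≃ₗ[K] (𝕎₁ × 𝕎₂) where
  toFun v := ((resL e v.1, resL e v.2), (resR e v.1, resR e v.2))
  invFun w := (glue e w.1.1 w.2.1, glue e w.1.2 w.2.2)
  map_add' _ _ := rfl
  map_smul' _ _ := rfl
  left_inv v := Prod.ext (glue_resL_resR e v.1) (glue_resL_resR e v.2)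
  right_inv w := by
    rcases w with ⟨⟨a, b⟩, ⟨a', b'⟩⟩
    simp only [resL_glue, resR_glue]

/-- formula. [cite: Kudla1984, §1] -/
@[simp] theorem splitW_apply (v : 𝕎) :
    splitW (K := K) e v = ((resL e v.1, resL e v.2), (resR e v.1, resR e v.2)) := rfl

/-- formula. [cite: Kudla1984, §1] -/
@[simp] theorem splitW_symm_apply (w : 𝕎₁ × 𝕎₂) :
    (splitW (K := K) e).symm w = (glue e w.1.1 w.2.1, glue e w.1.2 w.2.2) := rfl

/-- `g₁ ⊕ 1` as a linear automorphism of `W_T` (through `e`). [cite: Kudla1984, §1] -/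
def inlW (g₁ : 𝕎₁ ≃ₗ[K] 𝕎₁) : 𝕎 ≃ₗ[K] 𝕎 :=
  (splitW e).trans ((g₁.prodCongr (LinearEquiv.refl K 𝕎₂)).trans (splitW e).symm)

/-- formula: `(g₁ ⊕ 1)(x, y) = ((g₁(x|₁, y|₁)).1 ⊔ x|₂, (g₁(x|₁, y|₁)).2 ⊔ y|₂)`. [cite: Kudla1984, §1] -/
@[simp] theorem inlW_apply (g₁ : 𝕎₁ ≃ₗ[K] 𝕎₁) (v : 𝕎) :
    inlW e g₁ v = (glue e (g₁ (resL e v.1, resL e v.2)).1 (resR e v.1), glue e (g₁ (resL e v.1, resL e v.2)).2 (resR e v.2)) :=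
  rfl

/-- on glued vectors: `(g₁ ⊕ 1)(a ⊔ a', b ⊔ b') = ((g₁(a, b)).1 ⊔ a', (g₁(a, b)).2 ⊔ b')`. [cite: Kudla1984, §1] -/
theorem inlW_apply_glue (g₁ : 𝕎₁ ≃ₗ[K] 𝕎₁) (a b : ι₁ → K) (a' b' : ι₂ → K) :
    inlW e g₁ (glue e a a', glue e b b') = (glue e (g₁ (a, b)).1 a', glue e (g₁ (a, b)).2 b') := by
  simp only [inlW_apply, resL_glue, resR_glue]

/-- `1 ⊕ 1 = 1`. [cite: Kudla1984, §1] -/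
theorem inlW_one : inlW (K := K) e (1 : 𝕎₁ ≃ₗ[K] 𝕎₁) = 1 :=
  LinearEquiv.ext fun v => by simp only [inlW_apply, LinearEquiv.coe_one, id_eq, glue_resL_resR, Prod.mk.eta]

/-- `(g₁ g₁') ⊕ 1 = (g₁ ⊕ 1)(g₁' ⊕ 1)`. [cite: Kudla1984, §1] -/
theorem inlW_mul (g₁ g₁' : 𝕎₁ ≃ₗ[K] 𝕎₁) : inlW e (g₁ * g₁') = inlW e g₁ * inlW e g₁' :=
  LinearEquiv.ext fun v => by
    simp only [inlW_apply, LinearEquiv.mul_apply, resL_glue, resR_glue, Prod.mk.eta]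

/-- **`g₁ ⊕ 1` through `e` is the tree's `g₁ ⊕ 1` (`UnitaryGroup.spSumEquiv g₁ 1`) conjugated by the relabelling
`UnitaryGroup.reindexW e`** — the bridge to `IsQuadraticCoordinates.resAut_blockDiagGL` / `resAut_reindexGL`.
[cite: Kudla1984, §1] -/
theorem inlW_eq_reindexW_spSumEquiv (g₁ : 𝕎₁ ≃ₗ[K] 𝕎₁) :
    inlW e g₁ = ((UnitaryGroup.reindexW K e).symm.trans
      (UnitaryGroup.spSumEquiv g₁ (1 : 𝕎₂ ≃ₗ[K] 𝕎₂))).trans (UnitaryGroup.reindexW K e) := by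
  refine LinearEquiv.ext fun v => ?_
  obtain ⟨x, y⟩ := v
  rw [LinearEquiv.trans_apply, LinearEquiv.trans_apply, UnitaryGroup.reindexW_symm_apply, UnitaryGroup.spSumEquiv_apply,
    UnitaryGroup.reindexW_apply, inlW_apply, LinearEquiv.coe_one, id_eq]
  rfl

end Blocks

section Algebra

variable {K : Type*} [CommRing K] {ι₁ ι₂ ι : Type*} [Fintype ι₁] [Fintype ι₂] [Fintype ι]
  [DecidableEq ι₁] [DecidableEq ι₂] [DecidableEq ι]
  (e : ι₁ ⊕ ι₂ ≃ ι) (T₁ : Matrix ι₁ ι₁ K) (T₂ : Matrix ι₂ ι₂ K) {T : Matrix ι ι K}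
  (hT : T = Matrix.reindex e e (Matrix.fromBlocks T₁ 0 0 T₂))

local notation "𝕎" => ((ι → K) × (ι → K))
local notation "𝕎₁" => ((ι₁ → K) × (ι₁ → K))
local notation "𝕎₂" => ((ι₂ → K) × (ι₂ → K))

include hT in
/-- **`β_T(x, y) = β_{T₁}(x|₁, y|₁) + β_{T₂}(x|₂, y|₂)`**: the summands are orthogonal. [cite: Kudla1984, §1] -/
theorem toLinearMap₂'_blocks (x y : ι → K) :
    Matrix.toLinearMap₂' K T x y =
      Matrix.toLinearMap₂' K T₁ (resL e x) (resL e y) + Matrix.toLinearMap₂' K T₂ (resR e x) (resR e y) := by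
  have hx : (x ∘ e) ∘ e.symm = x := by funext k; simp
  have hy : (y ∘ e) ∘ e.symm = y := by funext k; simp
  conv_lhs => rw [hT, ← hx, ← hy, UnitaryGroup.toLinearMap₂'_reindex, UnitaryGroup.toLinearMap₂'_fromBlocks]
  rfl

include hT in
/-- `β_T(a ⊔ a', b ⊔ b') = β_{T₁}(a, b) + β_{T₂}(a', b')`. [cite: Kudla1984, §1] -/
theorem toLinearMap₂'_glue (a b : ι₁ → K) (a' b' : ι₂ → K) :
    Matrix.toLinearMap₂' K T (glue e a a') (glue e b b') = Matrix.toLinearMap₂' K T₁ a b + Matrix.toLinearMap₂' K T₂ a' b' := by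
  rw [toLinearMap₂'_blocks e T₁ T₂ hT, resL_glue, resL_glue, resR_glue, resR_glue]

/-- **`H(W_{T₁}) →* H(W_T)`**, `((a, b), t) ↦ ((a ⊔ 0, b ⊔ 0), t)` — a homomorphism because the summands are
`β_T`-orthogonal. [cite: Kudla1984, §1] -/
def inlH : Heisenberg (polar (Matrix.toLinearMap₂' K T₁)) →* Heisenberg (polar (Matrix.toLinearMap₂' K T)) where
  toFun h := ⟨(glue e h.v.1 0, glue e h.v.2 0), h.t⟩
  map_one' := by
    apply Heisenberg.ext
    · change (glue e (0 : ι₁ → K) (0 : ι₂ → K), glue e (0 : ι₁ → K) (0 : ι₂ → K)) = 0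
      rw [glue_zero, Prod.mk_zero_zero]
    · rfl
  map_mul' h h' := by
    apply Heisenberg.ext
    · change (glue e (h.v.1 + h'.v.1) (0 : ι₂ → K), glue e (h.v.2 + h'.v.2) (0 : ι₂ → K)) =
        (glue e h.v.1 0, glue e h.v.2 0) + (glue e h'.v.1 0, glue e h'.v.2 0)
      rw [Prod.mk_add_mk, glue_add, glue_add, add_zero]
    · change h.t + h'.t + polar (Matrix.toLinearMap₂' K T₁) h.v h'.v =
        h.t + h'.t + polar (Matrix.toLinearMap₂' K T) (glue e h.v.1 0, glue e h.v.2 0) (glue e h'.v.1 0, glue e h'.v.2 0)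
      rw [polar_apply, polar_apply, toLinearMap₂'_glue e T₁ T₂ hT, map_zero, add_zero]

/-- **`H(W_{T₂}) →* H(W_T)`**, `((a', b'), t) ↦ ((0 ⊔ a', 0 ⊔ b'), t)`. [cite: Kudla1984, §1] -/
def inrH : Heisenberg (polar (Matrix.toLinearMap₂' K T₂)) →* Heisenberg (polar (Matrix.toLinearMap₂' K T)) where
  toFun h := ⟨(glue e 0 h.v.1, glue e 0 h.v.2), h.t⟩
  map_one' := by
    apply Heisenberg.ext
    · change (glue e (0 : ι₁ → K) (0 : ι₂ → K), glue e (0 : ι₁ → K) (0 : ι₂ → K)) = 0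
      rw [glue_zero, Prod.mk_zero_zero]
    · rfl
  map_mul' h h' := by
    apply Heisenberg.ext
    · change (glue e (0 : ι₁ → K) (h.v.1 + h'.v.1), glue e (0 : ι₁ → K) (h.v.2 + h'.v.2)) =
        (glue e 0 h.v.1, glue e 0 h.v.2) + (glue e 0 h'.v.1, glue e 0 h'.v.2)
      rw [Prod.mk_add_mk, glue_add, glue_add, add_zero]
    · change h.t + h'.t + polar (Matrix.toLinearMap₂' K T₂) h.v h'.v =
        h.t + h'.t + polar (Matrix.toLinearMap₂' K T) (glue e 0 h.v.1, glue e 0 h.v.2) (glue e 0 h'.v.1, glue e 0 h'.v.2)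
      rw [polar_apply, polar_apply, toLinearMap₂'_glue e T₁ T₂ hT, map_zero, zero_add]

/-- vector part of `inlH h`. [cite: Kudla1984, §1] -/
@[simp] theorem inlH_v (h : Heisenberg (polar (Matrix.toLinearMap₂' K T₁))) :
    (inlH e T₁ T₂ hT h).v = (glue e h.v.1 0, glue e h.v.2 0) := rfl

/-- central part of `inlH h`. [cite: Kudla1984, §1] -/
@[simp] theorem inlH_t (h : Heisenberg (polar (Matrix.toLinearMap₂' K T₁))) : (inlH e T₁ T₂ hT h).t = h.t := rfl

/-- vector part of `inrH h`. [cite: Kudla1984, §1] -/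
@[simp] theorem inrH_v (h : Heisenberg (polar (Matrix.toLinearMap₂' K T₂))) :
    (inrH e T₁ T₂ hT h).v = (glue e 0 h.v.1, glue e 0 h.v.2) := rfl

/-- central part of `inrH h`. [cite: Kudla1984, §1] -/
@[simp] theorem inrH_t (h : Heisenberg (polar (Matrix.toLinearMap₂' K T₂))) : (inrH e T₁ T₂ hT h).t = h.t := rfl

/-- the `W₁`-part `h|₁ = ((a|₁, b|₁), t)` of `h = ((a, b), t) ∈ H(W_T)`. [cite: Kudla1984, §1] -/
def fstH (h : Heisenberg (polar (Matrix.toLinearMap₂' K T))) : Heisenberg (polar (Matrix.toLinearMap₂' K T₁)) :=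
  ⟨(resL e h.v.1, resL e h.v.2), h.t⟩

/-- the `W₂`-part `((a|₂, b|₂), 0)` of `h = ((a, b), t) ∈ H(W_T)` (central component put in the first factor). [cite: Kudla1984, §1] -/
def sndH (h : Heisenberg (polar (Matrix.toLinearMap₂' K T))) : Heisenberg (polar (Matrix.toLinearMap₂' K T₂)) :=
  ⟨(resR e h.v.1, resR e h.v.2), 0⟩

omit [Fintype ι₂] [DecidableEq ι₂] in
/-- formula. [cite: Kudla1984, §1] -/
@[simp] theorem fstH_v (h : Heisenberg (polar (Matrix.toLinearMap₂' K T))) :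
    (fstH e T₁ h).v = (resL e h.v.1, resL e h.v.2) := rfl

omit [Fintype ι₂] [DecidableEq ι₂] in
/-- formula. [cite: Kudla1984, §1] -/
@[simp] theorem fstH_t (h : Heisenberg (polar (Matrix.toLinearMap₂' K T))) : (fstH e T₁ h).t = h.t := rfl

omit [Fintype ι₁] [DecidableEq ι₁] in
/-- formula. [cite: Kudla1984, §1] -/
@[simp] theorem sndH_v (h : Heisenberg (polar (Matrix.toLinearMap₂' K T))) :
    (sndH e T₂ h).v = (resR e h.v.1, resR e h.v.2) := rfl

omit [Fintype ι₁] [DecidableEq ι₁] in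
/-- formula. [cite: Kudla1984, §1] -/
@[simp] theorem sndH_t (h : Heisenberg (polar (Matrix.toLinearMap₂' K T))) : (sndH e T₂ h).t = 0 := rfl

/-- **every element of `H(W_T)` factors**: `h = inlH(h|₁) · inrH(h|₂, 0)`. [cite: Weil1964, Chap. III n° 38 p. 190] -/
theorem inlH_fstH_mul_inrH_sndH (h : Heisenberg (polar (Matrix.toLinearMap₂' K T))) :
    inlH e T₁ T₂ hT (fstH e T₁ h) * inrH e T₁ T₂ hT (sndH e T₂ h) = h := by
  apply Heisenberg.ext
  · simp only [Heisenberg.mul_v, inlH_v, inrH_v, fstH_v, sndH_v, Prod.mk_add_mk, glue_add, add_zero, zero_add,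
      glue_resL_resR, Prod.mk.eta]
  · simp only [Heisenberg.mul_t, inlH_t, inrH_t, fstH_t, sndH_t, add_zero, polar_apply, inlH_v, inrH_v,
      toLinearMap₂'_glue e T₁ T₂ hT, map_zero, LinearMap.zero_apply]

include hT in
/-- **`g₁ ⊕ 1` is symplectic for `β_T` when `g₁` is symplectic for `β_{T₁}`.** [cite: Kudla1984, §1] -/
theorem inlW_mem {g₁ : 𝕎₁ ≃ₗ[K] 𝕎₁} (hg₁ : g₁ ∈ symplecticGroup (polar (Matrix.toLinearMap₂' K T₁))) :
    inlW e g₁ ∈ symplecticGroup (polar (Matrix.toLinearMap₂' K T)) := by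
  rw [mem_symplecticGroup] at hg₁ ⊢
  intro v w
  have h1 := hg₁ (resL e v.1, resL e v.2) (resL e w.1, resL e w.2)
  simp only [polar_apply] at h1
  simp only [polar_apply, inlW_apply, toLinearMap₂'_glue e T₁ T₂ hT, toLinearMap₂'_blocks e T₁ T₂ hT v.1 w.2,
    toLinearMap₂'_blocks e T₁ T₂ hT w.1 v.2]
  linear_combination h1

/-- **`Sp(W_{T₁}) →* Sp(W_T)`, `g₁ ↦ g₁ ⊕ 1`** (through `e`) — the first summand of the see-saw pair
`Sp(W₁) × Sp(W₂) ⊂ Sp(W₁ ⊕ W₂)`. [cite: Kudla1984, §1] -/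
def spInl : symplecticGroup (polar (Matrix.toLinearMap₂' K T₁)) →* symplecticGroup (polar (Matrix.toLinearMap₂' K T)) where
  toFun g₁ := ⟨inlW e (g₁ : 𝕎₁ ≃ₗ[K] 𝕎₁), inlW_mem e T₁ T₂ hT g₁.2⟩
  map_one' := Subtype.ext (inlW_one e)
  map_mul' g g' := Subtype.ext (inlW_mul e g.1 g'.1)

/-- `spInl g₁ = g₁ ⊕ 1` as an automorphism. [cite: Kudla1984, §1] -/
@[simp] theorem coe_spInl (g₁ : symplecticGroup (polar (Matrix.toLinearMap₂' K T₁))) :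
    ((spInl e T₁ T₂ hT g₁ : symplecticGroup (polar (Matrix.toLinearMap₂' K T))) : 𝕎 ≃ₗ[K] 𝕎) =
      inlW e (g₁ : 𝕎₁ ≃ₗ[K] 𝕎₁) := rfl

/-- `g₁ ↦ g₁ ⊕ 1` is injective. [cite: Kudla1984, §1] -/
theorem spInl_injective : Function.Injective (spInl e T₁ T₂ hT) := by
  intro g g' h
  have h' : inlW e (g : 𝕎₁ ≃ₗ[K] 𝕎₁) = inlW e (g' : 𝕎₁ ≃ₗ[K] 𝕎₁) := congrArg Subtype.val h
  refine Subtype.ext (LinearEquiv.ext fun w => ?_)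
  have := congrArg (fun G : 𝕎 ≃ₗ[K] 𝕎 => splitW e (G (glue e w.1 0, glue e w.2 0))) h'
  simp only [inlW_apply_glue, splitW_apply, resL_glue, resR_glue, Prod.mk.injEq] at this
  exact Prod.ext this.1.1 this.1.2

variable [Invertible (2 : K)]

/-- **`(g₁ ⊕ 1) · inlH h₁ = inlH (g₁ · h₁)`** for Weil's section `ofSymplectic` (its second-degree character
`f_{g₁ ⊕ 1}(a ⊔ 0, b ⊔ 0) = f_{g₁}(a, b)`). [cite: Weil1964, Chap. I n° 5 pp. 150–151] -/
theorem act_spInl_inlH (g₁ : symplecticGroup (polar (Matrix.toLinearMap₂' K T₁)))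
    (h₁ : Heisenberg (polar (Matrix.toLinearMap₂' K T₁))) :
    (ofSymplectic _ (spInl e T₁ T₂ hT g₁)).act (inlH e T₁ T₂ hT h₁) =
      inlH e T₁ T₂ hT ((ofSymplectic _ g₁).act h₁) := by
  apply Heisenberg.ext
  · simp only [Heisenberg.PseudoSymplectic.act_v, ofSymplectic_σ, inlH_v, coe_spInl, inlW_apply_glue, Prod.mk.eta]
  · simp only [Heisenberg.PseudoSymplectic.act_t, ofSymplectic_f, inlH_t, inlH_v, coe_spInl, inlW_apply_glue,
      polar_apply, toLinearMap₂'_glue e T₁ T₂ hT, map_zero, add_zero, Prod.mk.eta]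

/-- **`(g₁ ⊕ 1) · inrH h₂ = inrH h₂`**: the first summand fixes the Heisenberg group of the second.
[cite: Weil1964, Chap. I n° 5 pp. 150–151] -/
theorem act_spInl_inrH (g₁ : symplecticGroup (polar (Matrix.toLinearMap₂' K T₁)))
    (h₂ : Heisenberg (polar (Matrix.toLinearMap₂' K T₂))) :
    (ofSymplectic _ (spInl e T₁ T₂ hT g₁)).act (inrH e T₁ T₂ hT h₂) = inrH e T₁ T₂ hT h₂ := by
  apply Heisenberg.ext
  · simp only [Heisenberg.PseudoSymplectic.act_v, ofSymplectic_σ, inrH_v, coe_spInl, inlW_apply_glue,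
      Prod.mk_zero_zero, map_zero, Prod.fst_zero, Prod.snd_zero]
  · simp only [Heisenberg.PseudoSymplectic.act_t, ofSymplectic_f, inrH_t, inrH_v, coe_spInl, inlW_apply_glue,
      polar_apply, toLinearMap₂'_glue e T₁ T₂ hT, Prod.mk_zero_zero, map_zero, Prod.fst_zero, Prod.snd_zero,
      zero_add, sub_self, mul_zero, add_zero]

end Algebra

/-! ## §3 The Schrödinger operators of the summands on the products `f₁ ⊠ f₂` -/

section Schrodinger

open Literature.NumberTheory.GaloisRepresentations.IsNonarchimedeanLocalField

variable {K : Type*} [Field K] [ValuativeRel K] [TopologicalSpace K] [IsNonarchimedeanLocalField K]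
  {ι₁ ι₂ ι : Type*} [Fintype ι₁] [Fintype ι₂] [Fintype ι] [DecidableEq ι₁] [DecidableEq ι₂] [DecidableEq ι]
  (e : ι₁ ⊕ ι₂ ≃ ι) (T₁ : Matrix ι₁ ι₁ K) (T₂ : Matrix ι₂ ι₂ K) {T : Matrix ι ι K}
  (hT : T = Matrix.reindex e e (Matrix.fromBlocks T₁ 0 0 T₂))
  {ψ : AddChar K Circle} (hl : IsLocallyConstant (⇑ψ : K → Circle))
  (hb₁ : ∀ y : ι₁ → K, Continuous fun u : ι₁ → K => Matrix.toLinearMap₂' K T₁ u y)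
  (hb₂ : ∀ y : ι₂ → K, Continuous fun u : ι₂ → K => Matrix.toLinearMap₂' K T₂ u y)
  (hb : ∀ y : ι → K, Continuous fun u : ι → K => Matrix.toLinearMap₂' K T u y)

omit [ValuativeRel K] [IsNonarchimedeanLocalField K] [Fintype ι₂] [Fintype ι] [DecidableEq ι₂] [DecidableEq ι] in
/-- `u ↦ β_{T₁}(u, y)` is continuous (a linear form in finitely many coordinates). [cite: MoeglinVignerasWaldspurger1987, Chap. 2 I.4 Exemple (1)] -/
theorem continuous_toLinearMap₂'_left [IsTopologicalRing K] (y : ι₁ → K) :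
    Continuous fun u : ι₁ → K => Matrix.toLinearMap₂' K T₁ u y := by
  simp only [Matrix.toLinearMap₂'_apply', dotProduct]
  exact continuous_finsetSum _ fun i _ => (continuous_apply i).mul continuous_const

/-- **`ρ_T(inlH h₁)(f₁ ⊠ f₂) = ρ_{T₁}(h₁) f₁ ⊠ f₂`**: the Schrödinger operator of an element of the first summand acts
on the first variables only. [cite: MoeglinVignerasWaldspurger1987, Chap. 2 I.4 Exemple (1)] -/
theorem schrodingerSB_inlH_boxSB (h₁ : Heisenberg (polar (Matrix.toLinearMap₂' K T₁)))
    (f₁ : SchwartzBruhat (ι₁ → K)) (f₂ : SchwartzBruhat (ι₂ → K)) :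
    schrodingerSB (Matrix.toLinearMap₂' K T) ψ hl hb (inlH e T₁ T₂ hT h₁) (boxSB K e f₁ f₂) =
      boxSB K e (schrodingerSB (Matrix.toLinearMap₂' K T₁) ψ hl hb₁ h₁ f₁) f₂ := by
  apply Subtype.ext
  funext u
  have hu : Matrix.toLinearMap₂' K T u (glue e h₁.v.2 0) = Matrix.toLinearMap₂' K T₁ (resL e u) h₁.v.2 := by
    conv_lhs => rw [← glue_resL_resR e u]
    rw [toLinearMap₂'_glue e T₁ T₂ hT, map_zero, add_zero]
  rw [schrodingerSB_apply, coe_boxSB, coe_boxSB, inlH_t, inlH_v]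
  dsimp only
  rw [schrodingerSB_apply, hu, resL_add, resR_add, resL_glue, resR_glue, add_zero, mul_assoc]

/-- **`ρ_T(inrH h₂)(f₁ ⊠ f₂) = f₁ ⊠ ρ_{T₂}(h₂) f₂`**. [cite: MoeglinVignerasWaldspurger1987, Chap. 2 I.4 Exemple (1)] -/
theorem schrodingerSB_inrH_boxSB (h₂ : Heisenberg (polar (Matrix.toLinearMap₂' K T₂)))
    (f₁ : SchwartzBruhat (ι₁ → K)) (f₂ : SchwartzBruhat (ι₂ → K)) :
    schrodingerSB (Matrix.toLinearMap₂' K T) ψ hl hb (inrH e T₁ T₂ hT h₂) (boxSB K e f₁ f₂) =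
      boxSB K e f₁ (schrodingerSB (Matrix.toLinearMap₂' K T₂) ψ hl hb₂ h₂ f₂) := by
  apply Subtype.ext
  funext u
  have hu : Matrix.toLinearMap₂' K T u (glue e 0 h₂.v.2) = Matrix.toLinearMap₂' K T₂ (resR e u) h₂.v.2 := by
    conv_lhs => rw [← glue_resL_resR e u]
    rw [toLinearMap₂'_glue e T₁ T₂ hT, map_zero, zero_add]
  rw [schrodingerSB_apply, coe_boxSB, coe_boxSB, inrH_t, inrH_v]
  dsimp only
  rw [schrodingerSB_apply, hu, resL_add, resR_add, resL_glue, resR_glue, add_zero, mul_left_comm]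

/-- **`ρ_T ∘ inrH = 1 ⊠ ρ_{T₂}`** as linear operators on `𝒮(K^ι)`. [cite: MoeglinVignerasWaldspurger1987, Chap. 2 II.1 Rem. (6)] -/
theorem schrodingerSB_inrH_eq_sumEndSB (h₂ : Heisenberg (polar (Matrix.toLinearMap₂' K T₂))) :
    schrodingerSB (Matrix.toLinearMap₂' K T) ψ hl hb (inrH e T₁ T₂ hT h₂) =
      sumEndSB K e LinearMap.id (schrodingerSB (Matrix.toLinearMap₂' K T₂) ψ hl hb₂ h₂) := by
  apply linearMap_ext_boxSB K e
  intro f₁ f₂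
  rw [schrodingerSB_inrH_boxSB e T₁ T₂ hT hl hb₂ hb, sumEndSB_boxSB, LinearMap.id_apply]

/-- **`ρ_T ∘ inlH = ρ_{T₁} ⊠ 1`** as linear operators on `𝒮(K^ι)`. [cite: MoeglinVignerasWaldspurger1987, Chap. 2 II.1 Rem. (6)] -/
theorem schrodingerSB_inlH_eq_sumEndSB (h₁ : Heisenberg (polar (Matrix.toLinearMap₂' K T₁))) :
    schrodingerSB (Matrix.toLinearMap₂' K T) ψ hl hb (inlH e T₁ T₂ hT h₁) =
      sumEndSB K e (schrodingerSB (Matrix.toLinearMap₂' K T₁) ψ hl hb₁ h₁) LinearMap.id := by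
  apply linearMap_ext_boxSB K e
  intro f₁ f₂
  rw [schrodingerSB_inlH_boxSB e T₁ T₂ hT hl hb₁ hb, sumEndSB_boxSB, LinearMap.id_apply]

omit [DecidableEq ι₁] [DecidableEq ι₂] [DecidableEq ι] in
/-- `1_{𝒪^ι} = 1_{𝒪^{ι₁}} ⊠ 1_{𝒪^{ι₂}}`: the unramified vectors multiply (boxes split along `e`).
[cite: Weil1964, Chap. III n° 38 p. 190] -/
theorem indicator_piPrimePowBall_eq_boxSB (N : ℤ) :
    (⟨(piPrimePowBall K ι N).indicator fun _ => (1 : ℂ), indicator_piPrimePowBall_mem_schwartzBruhat N 1⟩ :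
        SchwartzBruhat (ι → K)) =
      boxSB K e ⟨(piPrimePowBall K ι₁ N).indicator fun _ => (1 : ℂ), indicator_piPrimePowBall_mem_schwartzBruhat N 1⟩
        ⟨(piPrimePowBall K ι₂ N).indicator fun _ => (1 : ℂ), indicator_piPrimePowBall_mem_schwartzBruhat N 1⟩ := by
  apply Subtype.ext
  funext v
  rw [coe_boxSB]
  dsimp only
  have h := mem_piPrimePowBall_iff_resL_resR K e (N := N) v
  by_cases h₁ : resL e v ∈ piPrimePowBall K ι₁ N
  · by_cases h₂ : resR e v ∈ piPrimePowBall K ι₂ N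
    · rw [Set.indicator_of_mem (h.2 ⟨h₁, h₂⟩), Set.indicator_of_mem h₁, Set.indicator_of_mem h₂, mul_one]
    · rw [Set.indicator_of_notMem (fun hv => h₂ (h.1 hv).2), Set.indicator_of_notMem h₂, mul_zero]
  · rw [Set.indicator_of_notMem (fun hv => h₁ (h.1 hv).1), Set.indicator_of_notMem h₁, zero_mul]

end Schrodinger

end Literature.RepresentationTheory.HeisenbergGroup

end
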